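import Summits.BirchSwinnertonDyer.BirchSwinnertonDyer.Theorems.TwoAdicConverseLambdaHalfTowerHiddenLambdaKit
import HarnessLib

/-!
# Route `TwoAdicConverse` (rung S3), crux `OrdLambdaHalfAtTwo` (item 19556): the HIDDEN-`λ` MODULE —
# mod-`p` tower counts CERTIFY the `λ`-half but can NEVER REFUTE it (a typed obstruction, pure `Λ`-module algebra)

Cell `bsd-2adic` (run/shared/lean/pub/bsd-2adic/), seat `bsd-2adic-conv-1x` (WIDTH-LEVER second lane on item 19556, GEN 5).
THEOREMS ONLY — no definition, no named fact, no axiom, no `sorry`; nothing about any curve.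

WHY. The K4 tower road reads, at the layers `ℚ_n` of the cyclotomic `ℤ₂`-extension, the numbers
`e_n = log₂ #X/(2, ω_n)X = log₂ #X/(2, T^{2ⁿ})X` of `X = X(E/ℚ_∞)` off `#Sel_{2^∞}(E/ℚ_n)[2]`, and uses them in ONE
direction only: a gap `e_{n+1} < e_n + 2ⁿ` ⟹ `X` torsion ∧ `μ = 0` (`isTorsion_and_mu_eq_zero_of_towerGapAtTwo`), and then
(`μ = 0`, no finite submodule) a lower count `2^k ≤ #X/(2,T^m)X` ⟹ `k ≤ λ(X)` (`KatoHalfPinch.le_lambda_…`). On the cell's open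
`E[2]`-irreducible «KH» block the counts SATURATE (`e = (2,3,5,9)`, no gap below layer `4`), and the bus recorded the informal
dichotomy «(μ = 0, λ = 9, e₄ = 9) or (μ ≥ 1, λ ≤ 1, e₄ ≥ 17)» (HOME/HANDOFF.md § ord-2 GEN 9 (4); repeated by this seat), whose
second branch would make a saturated layer-`4` count a REFUTATION of item 19556 at the curve. That branch is false, and this file
puts the reason in the kernel:

* `exists_hiddenLambda` — for every prime `p` and every `d ≥ 1` there is a finitely generated torsion `Λ = ℤ_p⟦T⟧`-module `X`
  WITHOUT nonzero finite submodules, with `λ(X) = d`, such that for EVERY ideal `𝔞 ∋ p` (so every tower ideal `(p, T^m)`)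
  `X/𝔞X ≃ (Λ/(p))/𝔞(Λ/(p))` as `Λ`-modules: all mod-`p` counts of `X` are those of `Λ/(p)` (`μ = 1`,
  `λ = 0`, `lambdaInvariant_quotient_augIdealP`). Construction: the fibre product `X = Λ/(p) ×_{Λ/(p,T^d)} Λ/(T^d + p)` — index `p^d` in
  the direct sum; `X/pX ≅ Λ/(p)` by the first projection (`nonempty_quotient_equiv`: the kernel of the first projection lies in `pX`
  because `T^d = −p` in `Λ/(T^d + p)`), `ℚ_p ⊗ X ≅ ℚ_p ⊗ Λ/(T^d + p) = ℚ_p^d` by the second (`lambdaInvariant_eq_of_fibreProduct`, tree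
  `finrank_baseChange_eq_of_pow_smul`, Weierstrass division `finrank_quotient_pow`); no finite submodule because `𝔽_p⟦T⟧ = Λ/(p)` has
  none (`finite_submodule_quotient_augIdealP_eq_bot`: `T^i − T^j ∉ (p)`) and `Λ/(T^d+p)` is `ℤ_p`-free.
* `exists_hiddenLambda_towerCounts_two` — the `p = 2` record in tower currency: `#X/(2,T^m)X = #(Λ/(2))/(2,T^m)` for every `m`,
  `λ(X) = d`, `λ(Λ/(2)) = 0`.

CONSEQUENCES (recorded in HOME/conv1x/NOTE-19556-conv1x-g5.md §8). (i) Every tree theorem of the tower road stands — the counts are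
used only in the certifying direction. (ii) A saturated count at layer `4` (or at every layer) at a KH class proves `μ ≥ 1 ∨ X`
non-torsion but does NOT bound `λ(X)` and so cannot refute the `λ`-half `λ(L₀) ≤ λ(X)`: the route's kill criterion «λ(L₂) > λ(X)»
is invisible to `X/2X` at any depth (it needs `X/4X`-type data or the characteristic ideal). (iii) The layer-`4` kits on the KH block
are certify-only instruments for S3.

HONEST FRAMING. A structural lemma about the road's certificates; it closes nothing and refutes nothing; item 19556 (= the `λ`-part
of the `2`-adic main conjecture on «non-CM, good ordinary at `2`») stays OPEN at the `∀`-level; nothing is booked; BSD is not proved by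
any of this. PARTITION (D-0054): none — RANK axis (S3); companion formula cell X5@2 good-ord open KH block (certificate semantics) ×
`p = 2` — types-the-object-of (obstruction); closes none; bears_on: S3 (19556), K4 (19271/19573: same counts, same one-sidedness).

References: L. Washington, GTM 83, §13.1 (`Λ/(p) = 𝔽_p⟦T⟧`), §13.2 (structure theory, pseudo-isomorphism, Prop. 13.8)
[Washington1997]; S. Lang, Cyclotomic Fields I–II, Ch. 5 §2 Thm. 2.1 (Weierstrass division) [Lang1980]; J. Neukirch, A. Schmidt,
K. Wingberg, Cohomology of Number Fields, (5.1.4) Remark 4 (finite = pseudo-null) [NeukirchSchmidtWingberg2008].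
-/

set_option linter.dupNamespace false
set_option autoImplicit false

noncomputable section

open scoped TensorProduct
open PowerSeries Literature.NumberTheory.EllipticCurves Literature.NumberTheory.EllipticCurves.IwasawaAlgebra
  Summit.BirchSwinnertonDyer.Rank1Residual.X5.TowerGap

namespace Summit.BirchSwinnertonDyer.BirchSwinnertonDyer.Theorems.TwoAdicTwistConverse.HiddenLambda

variable {p : ℕ} [hp : Fact p.Prime]

/-! ## §3 The hidden-`λ` module -/

section Main

variable (p)

/-- **HIDDEN `λ` (the obstruction).** For every `d ≥ 1` there is a finitely generated torsion `Λ`-module `X`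
(`Λ = ℤ_p⟦T⟧`) WITHOUT nonzero finite submodules, with `λ(X) = d`, all of whose quotients `X/𝔞X` by ideals
`𝔞 ∋ p` — in particular every mod-`p` tower quotient `X/(p, T^m)X` — are isomorphic to those of `Λ/(p)`
(`μ = 1`, `λ = 0`). Construction: `X = Λ/(p) ×_{Λ/(p,T^d)} Λ/(T^d + p)`, the fibre product (a submodule of
index `p^d` in the direct sum); `X/pX ≅ Λ/(p)` by the first projection, `ℚ_p ⊗ X ≅ ℚ_p ⊗ Λ/(T^d + p) = ℚ_p^d`
by the second. CONSEQUENCE for the tower road at `2`: the mod-`2` layer counts `#X/(2, ω_n)X` of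
`X = X(E/ℚ_∞)` can CERTIFY `λ(X) ≥ n` (through a gap: `μ = 0`, then a lower count) but can NEVER bound
`λ(X)` from above, hence never refute the `λ`-half `λ(L₀) ≤ λ(X)` (item 19556 at a curve): a module with
`μ ≥ 1` hides an arbitrary `λ` from every mod-`p` count. [cite: Washington1997, §13.2 (structure theory,
pseudo-isomorphism; Prop. 13.8)] -/
theorem exists_hiddenLambda (d : ℕ) (hd : d ≠ 0) :
    ∃ (X : Type) (_ : AddCommGroup X) (_ : Module (IwasawaAlgebra p) X),
      Module.Finite (IwasawaAlgebra p) X ∧ Module.IsTorsion (IwasawaAlgebra p) X ∧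
      (∀ N : Submodule (IwasawaAlgebra p) X, Finite N → N = ⊥) ∧
      lambdaInvariant p X = d ∧
      ∀ 𝔞 : Ideal (IwasawaAlgebra p), (C (p : ℤ_[p]) : IwasawaAlgebra p) ∈ 𝔞 →
        Nonempty ((X ⧸ (𝔞 • ⊤ : Submodule (IwasawaAlgebra p) X)) ≃ₗ[IwasawaAlgebra p]
          ((IwasawaAlgebra p ⧸ augIdealP p) ⧸
            (𝔞 • ⊤ : Submodule (IwasawaAlgebra p) (IwasawaAlgebra p ⧸ augIdealP p)))) := by
  -- the distinguished polynomial `g = T^d + p` and the three quotients `M = Λ/(p)`, `R = Λ/(g)`, `Q = Λ/(p, T^d)`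
  have hg := isDistinguishedAt_X_pow_add_C p d hd
  haveI := free_quotient_pow p hg 1
  haveI := finite_quotient_pow p hg 1
  have hMJ : augIdealP p ≤ Submodule.comap
      (LinearMap.id : IwasawaAlgebra p →ₗ[IwasawaAlgebra p] IwasawaAlgebra p) (towerIdeal p d) :=
    fun x hx => Ideal.mem_sup_left hx
  have hgJ : ((Polynomial.X ^ d + Polynomial.C (p : ℤ_[p]) : Polynomial ℤ_[p]) : IwasawaAlgebra p) ∈
      towerIdeal p d := by
    rw [coe_X_pow_add_C]
    exact Ideal.add_mem _ (Ideal.mem_sup_right (Ideal.pow_mem_pow (Ideal.mem_span_singleton_self _) d))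
      (Ideal.mem_sup_left (Ideal.mem_span_singleton_self _))
  have hRJ : Ideal.span {((Polynomial.X ^ d + Polynomial.C (p : ℤ_[p]) : Polynomial ℤ_[p]) :
      IwasawaAlgebra p) ^ 1} ≤ Submodule.comap
        (LinearMap.id : IwasawaAlgebra p →ₗ[IwasawaAlgebra p] IwasawaAlgebra p) (towerIdeal p d) := by
    rw [Submodule.comap_id, pow_one, Ideal.span_le, Set.singleton_subset_iff]
    exact hgJ
  set πM : (IwasawaAlgebra p ⧸ augIdealP p) →ₗ[IwasawaAlgebra p] (IwasawaAlgebra p ⧸ towerIdeal p d) :=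
    Submodule.mapQ _ _ LinearMap.id hMJ with hπM
  set πR : (IwasawaAlgebra p ⧸ Ideal.span {((Polynomial.X ^ d + Polynomial.C (p : ℤ_[p]) : Polynomial ℤ_[p]) :
      IwasawaAlgebra p) ^ 1}) →ₗ[IwasawaAlgebra p] (IwasawaAlgebra p ⧸ towerIdeal p d) :=
    Submodule.mapQ _ _ LinearMap.id hRJ with hπR
  have hMs : Function.Surjective πM := by
    intro q
    obtain ⟨r, rfl⟩ := Submodule.Quotient.mk_surjective _ q
    exact ⟨Submodule.Quotient.mk r, rfl⟩
  have hRs : Function.Surjective πR := by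
    intro q
    obtain ⟨r, rfl⟩ := Submodule.Quotient.mk_surjective _ q
    exact ⟨Submodule.Quotient.mk r, rfl⟩
  -- `ker πR ⊆ p·R`: `T^d = -p` in `R`
  have hkerR : ∀ b, πR b = 0 → ∃ r, b = (C (p : ℤ_[p]) : IwasawaAlgebra p) • r := by
    intro b hb
    obtain ⟨r₀, rfl⟩ := Submodule.Quotient.mk_surjective _ b
    have hr₀ : r₀ ∈ towerIdeal p d := by
      rw [hπR, Submodule.mapQ_apply, LinearMap.id_apply, Submodule.Quotient.mk_eq_zero] at hb
      exact hb
    rw [towerIdeal_eq_span_pair, Ideal.mem_span_pair] at hr₀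
    obtain ⟨u, v, huv⟩ := hr₀
    refine ⟨Submodule.Quotient.mk (u - v), ?_⟩
    rw [← Submodule.Quotient.mk_smul, smul_eq_mul, eq_comm, Submodule.Quotient.eq]
    -- `p (u - v) - r₀ = -v (T^d + p) ∈ (g)`
    rw [← huv, pow_one, coe_X_pow_add_C]
    refine Ideal.mem_span_singleton'.2 ⟨-v, ?_⟩
    ring
  -- the fibre product
  set X : Submodule (IwasawaAlgebra p) ((IwasawaAlgebra p ⧸ augIdealP p) ×
      (IwasawaAlgebra p ⧸ Ideal.span {((Polynomial.X ^ d + Polynomial.C (p : ℤ_[p]) : Polynomial ℤ_[p]) :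
        IwasawaAlgebra p) ^ 1})) :=
    LinearMap.ker (πM.comp (LinearMap.fst _ _ _) - πR.comp (LinearMap.snd _ _ _)) with hXdef
  have hX : ∀ x, x ∈ X ↔ πM x.1 = πR x.2 := by
    intro x
    rw [hXdef, LinearMap.mem_ker, LinearMap.sub_apply, LinearMap.comp_apply, LinearMap.comp_apply,
      LinearMap.fst_apply, LinearMap.snd_apply, sub_eq_zero]
  refine ⟨X, inferInstance, inferInstance, ?_, ?_, ?_, ?_, ?_⟩
  · -- finitely generated: a submodule of a finitely generated module over the Noetherian ring `Λ`
    haveI : IsNoetherian (IwasawaAlgebra p) ((IwasawaAlgebra p ⧸ augIdealP p) ×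
        (IwasawaAlgebra p ⧸ Ideal.span {((Polynomial.X ^ d + Polynomial.C (p : ℤ_[p]) : Polynomial ℤ_[p]) :
          IwasawaAlgebra p) ^ 1})) := isNoetherian_of_isNoetherianRing_of_finite _ _
    exact Module.Finite.of_injective X.subtype Subtype.val_injective
  · -- torsion: killed by `p · g ≠ 0`
    intro x
    have hg0 : ((Polynomial.X ^ d + Polynomial.C (p : ℤ_[p]) : Polynomial ℤ_[p]) : IwasawaAlgebra p) ≠ 0 := by
      rw [Ne, Polynomial.coe_eq_zero_iff]
      exact hg.monic.ne_zero
    have hp0 : (C (p : ℤ_[p]) : IwasawaAlgebra p) ≠ 0 := by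
      intro h
      rw [← map_zero PowerSeries.C, PowerSeries.C_injective.eq_iff] at h
      exact (Fact.out : p.Prime).ne_zero (by exact_mod_cast h)
    refine ⟨⟨C (p : ℤ_[p]) * ((Polynomial.X ^ d + Polynomial.C (p : ℤ_[p]) : Polynomial ℤ_[p]) :
      IwasawaAlgebra p), mem_nonZeroDivisors_of_ne_zero (mul_ne_zero hp0 hg0)⟩, ?_⟩
    apply Subtype.ext
    rw [Submonoid.mk_smul, Submodule.coe_smul, Submodule.coe_zero]
    ext
    · rw [Prod.smul_fst, mul_comm, mul_smul, C_p_smul_quotient_augIdealP, smul_zero, Prod.fst_zero]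
    · rw [Prod.smul_snd, mul_smul, Prod.snd_zero]
      obtain ⟨b₀, hb₀⟩ := Submodule.Quotient.mk_surjective _ x.val.2
      rw [← hb₀, ← Submodule.Quotient.mk_smul, ← Submodule.Quotient.mk_smul, smul_eq_mul, smul_eq_mul,
        Submodule.Quotient.mk_eq_zero]
      exact Ideal.mul_mem_left _ _ (Ideal.mem_span_singleton'.2 ⟨b₀, by rw [pow_one, mul_comm]⟩)
  · -- no nonzero finite submodule
    exact finite_submodule_eq_bot_of_fibreProduct X (finite_submodule_quotient_augIdealP_eq_bot p)
      (fun b n h => eq_zero_of_C_p_pow_smul_eq_zero_quotient p d hd b n h)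
  · -- `λ(X) = rank_{ℤ_p} Λ/(g) = d`
    rw [lambdaInvariant_eq_of_fibreProduct πM πR X hX hMs (C_p_smul_quotient_augIdealP p),
      Module.finrank_baseChange, finrank_quotient_pow p hg 1, Polynomial.natDegree_X_pow_add_C, one_mul]
  · -- the quotients
    intro 𝔞 h𝔞
    exact nonempty_quotient_equiv πM πR X hX hMs hRs (C_p_smul_quotient_augIdealP p) hkerR 𝔞 h𝔞

/-- **Contrast: `λ(Λ/(p)) = 0`** — the module whose mod-`p` quotients the hidden-`λ` module shares has
`λ = 0` (`ℚ_p ⊗ Λ/(p) = 0`, every element being killed by `p`). [cite: Washington1997, §13.2] -/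
theorem lambdaInvariant_quotient_augIdealP : lambdaInvariant p (IwasawaAlgebra p ⧸ augIdealP p) = 0 := by
  unfold lambdaInvariant
  haveI : Subsingleton (ℚ_[p] ⊗[ℤ_[p]]
      RestrictScalars ℤ_[p] (IwasawaAlgebra p) (IwasawaAlgebra p ⧸ augIdealP p)) := by
    refine subsingleton_of_forall_eq 0 fun z ↦ ?_
    induction z using TensorProduct.induction_on with
    | zero => rfl
    | tmul q x =>
      have hx : ((p : ℤ_[p]) ^ 1) • x = 0 := by
        change (algebraMap ℤ_[p] (IwasawaAlgebra p) ((p : ℤ_[p]) ^ 1)) •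
          (show IwasawaAlgebra p ⧸ augIdealP p from x) = (0 : IwasawaAlgebra p ⧸ augIdealP p)
        rw [← PowerSeries.C_eq_algebraMap, map_pow, pow_one]
        exact C_p_smul_quotient_augIdealP p _
      have hc0 : (((p : ℤ_[p]) ^ 1 : ℤ_[p]) : ℚ_[p]) ≠ 0 := by
        rw [PadicInt.coe_pow, PadicInt.coe_natCast]
        exact pow_ne_zero _ (Nat.cast_ne_zero.mpr hp.out.ne_zero)
      have hq : q = ((p : ℤ_[p]) ^ 1) • ((((p : ℤ_[p]) ^ 1 : ℤ_[p]) : ℚ_[p])⁻¹ * q) := by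
        rw [Algebra.smul_def, ← mul_assoc]
        change q = (((p : ℤ_[p]) ^ 1 : ℤ_[p]) : ℚ_[p]) * ((((p : ℤ_[p]) ^ 1 : ℤ_[p]) : ℚ_[p]))⁻¹ * q
        rw [mul_inv_cancel₀ hc0, one_mul]
      rw [hq, TensorProduct.smul_tmul, hx, TensorProduct.tmul_zero]
    | add a b ha hb => rw [ha, hb, add_zero]
  exact Module.finrank_zero_of_subsingleton

/-- **HIDDEN `λ` AT `p = 2`, tower form** (the S3 record, route `TwoAdicConverse`, item 19556): for every `d ≥ 1` a
finitely generated torsion `ℤ₂⟦T⟧`-module without nonzero finite submodules, with `λ = d`, whose mod-`2` tower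
counts `#X/(2, T^m)X` — the numbers the K4 tower kits read off `#Sel_{2^∞}(E/ℚ_n)[2]` at `m = 2ⁿ` — coincide for
EVERY `m` with those of `Λ/(2)` (`μ = 1`, `λ = 0`). So saturated layer counts (no gap at any layer) prove nothing
about `λ(X)`: they CERTIFY the `λ`-half only through a gap (`μ = 0`) and can never REFUTE it. [cite: Washington1997, §13.2] -/
theorem exists_hiddenLambda_towerCounts_two (d : ℕ) (hd : d ≠ 0) :
    ∃ (X : Type) (_ : AddCommGroup X) (_ : Module (IwasawaAlgebra 2) X),
      Module.Finite (IwasawaAlgebra 2) X ∧ Module.IsTorsion (IwasawaAlgebra 2) X ∧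
      (∀ N : Submodule (IwasawaAlgebra 2) X, Finite N → N = ⊥) ∧
      lambdaInvariant 2 X = d ∧ lambdaInvariant 2 (IwasawaAlgebra 2 ⧸ augIdealP 2) = 0 ∧
      ∀ m : ℕ, Nat.card (X ⧸ (towerIdeal 2 m • ⊤ : Submodule (IwasawaAlgebra 2) X)) =
        Nat.card ((IwasawaAlgebra 2 ⧸ augIdealP 2) ⧸
          (towerIdeal 2 m • ⊤ : Submodule (IwasawaAlgebra 2) (IwasawaAlgebra 2 ⧸ augIdealP 2))) := by
  obtain ⟨X, _, _, hfin, htors, hnf, hlam, hquot⟩ := exists_hiddenLambda 2 d hd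
  refine ⟨X, inferInstance, inferInstance, hfin, htors, hnf, hlam, lambdaInvariant_quotient_augIdealP 2,
    fun m => ?_⟩
  obtain ⟨e⟩ := hquot (towerIdeal 2 m) (Ideal.mem_sup_left (Ideal.mem_span_singleton_self _))
  exact Nat.card_congr e.toEquiv

end Main

end Summit.BirchSwinnertonDyer.BirchSwinnertonDyer.Theorems.TwoAdicTwistConverse.HiddenLambda

end
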